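import Mathlib
import Summits.ResolutionOfSingularities.ResolutionOfSingularities.Theorems.FrobeniusLadderFRationalResolutionCompletedBaseChangeFibreChart
import Summits.ResolutionOfSingularities.ResolutionOfSingularities.Theorems.FrobeniusLadderFRationalResolutionBlowupChartPoints
import Literature.AlgebraicGeometry.Resolution.BlowupChartTransition

/-!
# Crux `FrobeniusLadder.FRationalResolution` (stmt-ResolutionOfSingularities-15317), line `redirect`,
# stub `stub_diagonalizableQuotientResolution` — THE TRANSPORT STEP (T): FINITELY MANY SINGULAR POINTS OF `Bl_{J₀B}(Spec B)`,
# read off on the MODEL chart rings `T[J₀/x_i]`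

Sixth file of the (T) series (`…CompletedBaseChangeFibre`, `…Flat`, `…Chart`, `…Completion`, `…Points`). The consumer
`…SingularPointsFinite.hloc_of_maximalIdealPow_then_finite_singularPoints` needs `(Reg X₁)ᶜ` FINITE for
`X₁ = Bl_{J}(Spec Ê)`; here this is produced from the model: for `T` of finite type over a field, `B` a Noetherian flat `T`-algebra
with `B = T + 𝔳B` and `𝔳B ∩ T ⊆ 𝔳` (e.g. `B = (T_𝔳)^`, `𝔳` maximal), `J₀ = (x₁, …, x_n) ⊆ T`, `X₁ = Bl_{J₀B}(Spec B)`: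
* ★★★ **`finite_compl_regularLocus_of_charts`** — if every model chart ring `T[J₀/x_i]` has finitely many non-regular primes over
  `V(𝔳)`, and the singular points of `X₁` lie over `V(𝔳B)` (tree `…SingularPointsOverVertex.le_of_not_mem_regularLocus_of_pow_le`
  when `J₀B` is `𝔪`-primary and `Spec B ∖ V(𝔪)` is regular), then **`(Reg X₁)ᶜ` is finite**: every singular point of `X₁` lies
  on a chart `D₊(x_i t) ≅ Spec B[J₀B/x_i]` at a non-regular prime over `V(𝔳)` (`…BlowupChartPoints.exists_chart_point_prime`), and
  these are finitely many by `…CompletedBaseChangeFibreChart.finite_not_isRegularLocalRing_blowupAlgebra`;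
* ★★★ `finite_compl_regularLocus_of_model_charts` — the case `B = (T_𝔳)^`, `𝔳` maximal, all base-change hypotheses discharged.
Together with `…CompletedBaseChangeFibrePoints.hloc_stalk_of_model_charts` this completes the INPUTS `hfin` + `hloc` of the
two-step recipes in the model presentation `Ê = (T_𝔳)^`, from purely chart-ring-level («fan») facts about `Bl_{J₀}(Spec T)`.
What remains of (T): the passage to the consumers' Galois presentation `((B' ⊗_K K')_{𝔔'})^ ≅ (T_𝔳)^` along the ring
isomorphism of g19/g20 (transport of `affineBlowup` data along a ring isomorphism of the base).

Honest label: plumbing toward ONE leaf stub (no stub, crux or summit closed). No definitions, no named facts, no sorry.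
[cite: StacksProject, Tag 0804; Tag 0805] [cite: GortzWedhorn2020, Prop. 13.91 (2); (13.19) p. 415] [cite: Matsumura1987, Thm. 8.14]
-/

noncomputable section

-- single-problem summit: the doubled namespace component is forced
set_option linter.dupNamespace false

open IsLocalRing AlgebraicGeometry CategoryTheory
open scoped TensorProduct
open Literature.AlgebraicGeometry.Resolution

namespace Summit.ResolutionOfSingularities.ResolutionOfSingularities.Theorems.FRationalResolution.CompletedBaseChangeFibreFinite

/-- ★★★ **FINITELY MANY SINGULAR POINTS OF `X₁ = Bl_{J₀B}(Spec B)` FROM THE MODEL CHARTS** (generic base change; see the module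
docstring). [cite: StacksProject, Tag 0804; Tag 0805] [cite: GortzWedhorn2020, (13.19) p. 415] [cite: Matsumura1987, Thm. 8.14] -/
theorem finite_compl_regularLocus_of_charts (K : Type) [Field K] (T : Type) [CommRing T] [Algebra K T]
    [Algebra.FiniteType K T] (𝔳 : Ideal T) (B : Type) [CommRing B] [Algebra T B] [IsNoetherianRing B] [Module.Flat T B]
    (hres : ∀ b : B, ∃ t : T, b - algebraMap T B t ∈ 𝔳.map (algebraMap T B))
    (hinj : (𝔳.map (algebraMap T B)).comap (algebraMap T B) ≤ 𝔳)
    {n : ℕ} (x : Fin n → T) (J₀ : Ideal T) (hJ₀ : J₀ = Ideal.span (Set.range x))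
    (hfin : ∀ i : Fin n, {𝔫 : PrimeSpectrum (blowupAlgebra J₀ (x i)) |
      𝔳.map (algebraMap T (blowupAlgebra J₀ (x i))) ≤ 𝔫.asIdeal ∧
        ¬ IsRegularLocalRing (Localization.AtPrime 𝔫.asIdeal)}.Finite)
    (hZ : ∀ z : affineBlowup (J₀.map (algebraMap T B)), z ∉ Scheme.regularLocus (affineBlowup (J₀.map (algebraMap T B))) →
      𝔳 ≤ (affineBlowup.π (J₀.map (algebraMap T B)) z).asIdeal.comap (algebraMap T B)) :
    (Scheme.regularLocus (affineBlowup (J₀.map (algebraMap T B))))ᶜ.Finite := by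
  classical
  haveI : IsNoetherianRing T := Algebra.FiniteType.isNoetherianRing K T
  have hxJ : ∀ i, algebraMap T B (x i) ∈ J₀.map (algebraMap T B) := fun i =>
    Ideal.mem_map_of_mem _ (hJ₀ ▸ Ideal.subset_span ⟨i, rfl⟩)
  have hJle : J₀.map (algebraMap T B) ≤ Ideal.span (Set.range fun i => algebraMap T B (x i)) := by
    rw [hJ₀, Ideal.map_span, ← Set.range_comp]
    exact le_rfl
  haveI : ∀ i, IsNoetherianRing (blowupAlgebra J₀ (x i)) := fun i =>
    isNoetherianRing_blowupAlgebra_of_isNoetherianRing J₀ (x i)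
  haveI : ∀ i, IsNoetherianRing (blowupAlgebra (J₀.map (algebraMap T B)) (algebraMap T B (x i))) := fun i =>
    isNoetherianRing_blowupAlgebra_of_isNoetherianRing (J₀.map (algebraMap T B)) (algebraMap T B (x i))
  -- the finite sets of singular chart primes over `V(𝔳)`, upstairs
  have hfin' : ∀ i : Fin n, {𝔑' : PrimeSpectrum (blowupAlgebra (J₀.map (algebraMap T B)) (algebraMap T B (x i))) |
      𝔳.map (algebraMap T (blowupAlgebra J₀ (x i))) ≤
          𝔑'.asIdeal.comap (blowupAlgebraMap (algebraMap T B) J₀ (J₀.map (algebraMap T B)) (x i) le_rfl) ∧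
        ¬ IsRegularLocalRing (Localization.AtPrime 𝔑'.asIdeal)}.Finite := fun i =>
    CompletedBaseChangeFibreChart.finite_not_isRegularLocalRing_blowupAlgebra J₀ (J₀.map (algebraMap T B)) (x i) le_rfl
      le_rfl 𝔳 hres hinj (hfin i)
  -- the chart maps on points
  let G : ∀ i : Fin n, PrimeSpectrum (blowupAlgebra (J₀.map (algebraMap T B)) (algebraMap T B (x i))) →
      affineBlowup (J₀.map (algebraMap T B)) := fun i 𝔑' =>
    Proj.awayι (reesGrading (J₀.map (algebraMap T B))) (reesT (algebraMap T B (x i)) (hxJ i))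
      (reesT_mem (algebraMap T B (x i)) (hxJ i)) one_pos
      (PrimeSpectrum.comap (reesChartEquiv (I := J₀.map (algebraMap T B)) (algebraMap T B (x i)) (hxJ i)).toRingHom 𝔑')
  refine Set.Finite.subset (Set.finite_iUnion fun i => (hfin' i).image (G i)) ?_
  intro z hz
  rw [Set.mem_compl_iff, Scheme.mem_regularLocus] at hz
  obtain ⟨i, q, 𝔑', h𝔑'p, hq, hmemq, hcomap, hiff⟩ :=
    BlowupChartPoints.exists_chart_point_prime (J₀.map (algebraMap T B)) (fun i => algebraMap T B (x i)) hxJ hJle z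
  haveI := h𝔑'p
  refine Set.mem_iUnion.mpr ⟨i, ⟨𝔑', h𝔑'p⟩, ⟨?_, fun hreg => hz (hiff.mpr hreg)⟩, ?_⟩
  · -- over `V(𝔳)`
    have hz' : z ∉ Scheme.regularLocus (affineBlowup (J₀.map (algebraMap T B))) := by
      rw [Scheme.mem_regularLocus]; exact hz
    change 𝔳.map (algebraMap T (blowupAlgebra J₀ (x i))) ≤
      𝔑'.comap (blowupAlgebraMap (algebraMap T B) J₀ (J₀.map (algebraMap T B)) (x i) le_rfl)
    rw [Ideal.map_le_iff_le_comap, Ideal.comap_comap, blowupAlgebraMap_comp_algebraMap, ← Ideal.comap_comap, hcomap]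
    exact hZ z hz'
  · -- `G i 𝔑' = z`
    have hpt : PrimeSpectrum.comap (reesChartEquiv (I := J₀.map (algebraMap T B)) (algebraMap T B (x i)) (hxJ i)).toRingHom
        ⟨𝔑', h𝔑'p⟩ = q := by
      refine PrimeSpectrum.ext ?_
      ext s
      rw [PrimeSpectrum.comap_asIdeal, Ideal.mem_comap, hmemq]
      exact Iff.rfl
    rw [← hq, ← hpt]

/-- ★★★ **FINITELY MANY SINGULAR POINTS OF `X₁ = Bl_{J₀Ê}(Spec Ê)`, `Ê = (T_𝔳)^`, FROM THE MODEL CHARTS** (`𝔳` maximal; all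
base-change hypotheses discharged by `…CompletedBaseChangeFibreFlat` §4). [cite: StacksProject, Tag 0804; Tag 0805]
[cite: Matsumura1987, Thm. 8.14] -/
theorem finite_compl_regularLocus_of_model_charts (K : Type) [Field K] (T : Type) [CommRing T] [Algebra K T]
    [Algebra.FiniteType K T] (𝔳 : Ideal T) [𝔳.IsMaximal]
    {n : ℕ} (x : Fin n → T) (J₀ : Ideal T) (hJ₀ : J₀ = Ideal.span (Set.range x))
    (hfin : ∀ i : Fin n, {𝔫 : PrimeSpectrum (blowupAlgebra J₀ (x i)) |
      𝔳.map (algebraMap T (blowupAlgebra J₀ (x i))) ≤ 𝔫.asIdeal ∧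
        ¬ IsRegularLocalRing (Localization.AtPrime 𝔫.asIdeal)}.Finite)
    (hZ : ∀ z : affineBlowup (J₀.map (algebraMap T (AdicCompletion (maximalIdeal (Localization.AtPrime 𝔳))
        (Localization.AtPrime 𝔳)))), z ∉ Scheme.regularLocus (affineBlowup (J₀.map (algebraMap T
          (AdicCompletion (maximalIdeal (Localization.AtPrime 𝔳)) (Localization.AtPrime 𝔳))))) →
      𝔳 ≤ (affineBlowup.π (J₀.map (algebraMap T (AdicCompletion (maximalIdeal (Localization.AtPrime 𝔳))
        (Localization.AtPrime 𝔳)))) z).asIdeal.comap (algebraMap T _)) :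
    (Scheme.regularLocus (affineBlowup (J₀.map (algebraMap T (AdicCompletion (maximalIdeal (Localization.AtPrime 𝔳))
      (Localization.AtPrime 𝔳))))))ᶜ.Finite := by
  haveI : IsNoetherianRing T := Algebra.FiniteType.isNoetherianRing K T
  haveI : IsNoetherianRing (Localization.AtPrime 𝔳) :=
    IsLocalization.isNoetherianRing 𝔳.primeCompl (Localization.AtPrime 𝔳) inferInstance
  haveI : IsNoetherianRing (AdicCompletion (maximalIdeal (Localization.AtPrime 𝔳)) (Localization.AtPrime 𝔳)) :=
    isNoetherianRing_adicCompletion_maximalIdeal _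
  haveI := CompletedBaseChangeFibreFlat.flat_adicCompletion_atPrime T 𝔳
  exact finite_compl_regularLocus_of_charts K T 𝔳 _ (CompletedBaseChangeFibreFlat.forall_exists_sub_mem_adicCompletion_atPrime T 𝔳)
    (CompletedBaseChangeFibreFlat.comap_map_le_adicCompletion_atPrime T 𝔳) x J₀ hJ₀ hfin hZ

end Summit.ResolutionOfSingularities.ResolutionOfSingularities.Theorems.FRationalResolution.CompletedBaseChangeFibreFinite

end
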